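/-
Copyright (c) 2026 the pub-hodgecm-mathlib formalisation cell (harness21).  Prover seat hodgecm-mathlib-F0P3a-p02 (g19): LH3 «Transf» road,
brick (π) GENERIC PROPAGATION of the jump clause (dealer LH3-plan (g3) 2026-09-02 07:53Z BY NAME; shape LH7-p02 (g2) 07:53:11Z (2); consumers
(I₃-TRANSF) ED. 2 (LH7-p02), (J-H) (LH10-p02 ∕ LH5-p04)).
-/
import Literature.NumberTheory.Rogawski1990.ArchBouazizSpaceH                    -- ★ D2: `ArchBzSmoothBounded`, `ArchBzJump`, `bzTwistedDeriv`, `bzAdaptedVec`, `bzCayVec`, `bzCayScalar`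
import Literature.NumberTheory.Rogawski1990.ArchBouazizStableFamilyCayleyValue    -- ★ LH5-p04 (g2): `cayPt_mem_inRegS_insert_of_semiregular`
import Literature.NumberTheory.Automorphic.ArchCartanRegularDense                 -- ★ LH3-p01 (g3): `circleExp_add_mul_ne_of_not_mem`
import Literature.NumberTheory.Automorphic.Shelstad1979.OneSidedJumpUnique         -- ★ F0P3a-p04 (g22): `HasOneSidedJump.unique`
import Literature.Analysis.Calculus.OneSidedJetContinuity                         -- ★ (WALL-CONT): `exists_continuousOn_oneSided_iteratedFDeriv_pair`
import Literature.Analysis.Calculus.BoundedJetsLeibnizReflection                  -- ★ (a1): `bddAbove_norm_iteratedFDeriv_mul_inter_of_isCompact`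
import HarnessLib

/-!
# (π) Propagation of Bouaziz's jump clause (I₃) from the `G`-semiregular wall points to every semiregular wall point

Topic `NumberTheory/Rogawski1990`; namespace `Literature.NumberTheory.Rogawski1990`.  THEOREMS ONLY (no definition, no instance, no notation, no named fact, no
`sorry`); group-free (functions of the Cartan coordinates `c : W → Fin 3 → ℝ`).  Cell `pub/hodgecm-mathlib`, line LH3 (closer stub `stub_N9`, crux H413 =
`stmt-HodgeConjecture-24833`), DIRECT ROAD organ O-L2 «Transf», payment (I₃-TRANSF) (LH7-p02 (g2)): its ED. 1 proves the jump relations of the transfer family at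
the `G`-SEMIREGULAR wall points (third eigenvalue off the colliding pair, regular at the other places), where Harish-Chandra's (I₃) for the `G′`-family is
available; ★ `ArchBzJump` asks them at every `H`-SEMIREGULAR wall point (`s w₀ 0 = s w₀ 2`, `H`-regular elsewhere).  THIS FILE closes the gap for ANY family
`Ψ` with Bouaziz's (I₁)+(I₂) ★ `ArchBzSmoothBounded Ψ`:

**`archBzJump_of_forall_gSemireg (hSB : ArchBzSmoothBounded Ψ) (h : <the clause at the G-semiregular wall points>) : ArchBzJump jcH Ψ`.**

MECHANISM (A. Bouaziz, *Intégrales orbitales sur les groupes de Lie réductifs*, Ann. Sci. ÉNS 27 (1994), §3.2 p. 579: «(I₁) et le lemme 1-3-21 de [V] impliquent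
que … la fonction ∂(u)ψ_H se prolonge par continuité à l'adhérence de F.  Cela justifie l'existence des limites dans la propriété (I₃)»; D. Shelstad, Compositio
Math. 39 (1979), §4 p. 22, Prop. 4.5 p. 26).  Fix `S`, `w₀ ∉ S`, a word `m`.  On the open set
`U := {|c_{w₀0} − c_{w₀2}| < 2π} ∩ InRegS (insert w₀ S) ∩ {x_w ≠ 0, w ∈ S}` (whose trace on the hyperplane `{c_{w₀0} = c_{w₀2}}` IS `ArchBzJump`'s wall scope, and
with `U ∖ wall ⊆ InRegS S`) the twisted function `f := archERho S · Ψ S` is `C^∞` off the wall with every jet bounded near the wall ((SB) + Leibniz ★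
`bddAbove_norm_iteratedFDeriv_mul_inter_of_isCompact`), so ★ `exists_continuousOn_oneSided_iteratedFDeriv_pair` gives one-sided jet fields `g±` CONTINUOUS on the
closed sides; the one-sided limits of the clause's left side are `L±(s) = (archERho S s)⁻¹ · g±(s)(dirs)`, continuous along the wall; the right side
`jcH · bzCayScalar · bzTwistedDeriv (insert w₀ S) … (cayPt w₀ s)` is continuous along the wall too ((SB) on the OPEN `InRegS (insert w₀ S)` ∋ `cayPt w₀ s`, ★
`cayPt_mem_inRegS_insert_of_semiregular`); the `G`-semiregular points are DENSE in the wall scope (`mem_closure_gSemireg`: move the odd angles, countably many bad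
parameters, ★ `circleExp_add_mul_ne_of_not_mem`); on them `L₊ − L₋ =` right side by `h` and ★ `HasOneSidedJump.unique`; `Set.EqOn.of_subset_closure` finishes.
ALL orders `n`, ALL words `m`, no Leibniz formula.

## References
* [Bouaziz1994IntegralesOrbitales] A. Bouaziz, Ann. Sci. ÉNS (4) 27 (1994), §3.2 (I₁)–(I₃) pp. 579–580; §6.2 p. 591.
* [Shelstad1979] D. Shelstad, Compositio Math. 39 (1979), §4: p. 22 (semiregular elements), Lemma 4.3 p. 25, Prop. 4.5 p. 26, Thm. 4.7 (IIIb) p. 31.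
-/

set_option autoImplicit false

noncomputable section

open Set Filter Topology Complex Metric Function Real
open scoped ContDiff
open Literature.NumberTheory.Automorphic.Shelstad1979.StableOrbitalIntegrals
open Literature.NumberTheory.Automorphic.ArchCartan
open Literature.Analysis.Calculus

namespace Literature.NumberTheory.Rogawski1990

variable {W : Type*} [Fintype W] [DecidableEq W]

/-! ## §1 Small tools: the twist is smooth, injectivity on `Fin 3`, the twisted derivative is continuous on `T_{in-reg}` -/

/-- **THE TWIST `archERho S` IS `C^∞`** (a product of unit exponentials of the coordinates; twin of ★ `contDiff_archERhoG`). [cite: Shelstad1979, §4 p. 24] -/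
theorem contDiff_archERho (S : Finset W) : ContDiff ℝ ∞ (archERho S) := by
  have h : archERho S = fun c => ∏ w, (if w ∈ S then (1 : ℂ) else Complex.exp ((((c w 0 : ℂ) - (c w 2 : ℂ)) / 2) * I)) := by
    funext c
    unfold archERho
    refine Finset.prod_congr rfl fun w _ => ?_
    split_ifs
    · rfl
    · rw [Circle.coe_exp]; push_cast; ring_nf
  rw [h]
  refine contDiff_prod fun w _ => ?_
  split_ifs
  · exact contDiff_const
  · refine Complex.contDiff_exp.comp (ContDiff.mul (ContDiff.div_const (ContDiff.sub ?_ ?_) _) contDiff_const)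
    · exact ofRealCLM.contDiff.comp ((contDiff_apply (𝕜 := ℝ) (E := ℝ) (n := ∞) (0 : Fin 3)).comp (contDiff_apply (𝕜 := ℝ) (E := Fin 3 → ℝ) (n := ∞) w))
    · exact ofRealCLM.contDiff.comp ((contDiff_apply (𝕜 := ℝ) (E := ℝ) (n := ∞) (2 : Fin 3)).comp (contDiff_apply (𝕜 := ℝ) (E := Fin 3 → ℝ) (n := ∞) w))

omit [Fintype W] [DecidableEq W] in
/-- A map on `Fin 3` with pairwise distinct values is injective (private copy of ★ `Literature.Probability.Percolation.injective_fin_three`, kept local to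
avoid a cross-topic import). [cite: Shelstad1979, §4 p. 22] -/
private theorem injective_of_fin_three' {α : Type*} {f : Fin 3 → α} (h01 : f 0 ≠ f 1) (h02 : f 0 ≠ f 2) (h12 : f 1 ≠ f 2) : Function.Injective f := by
  intro i j hij
  fin_cases i <;> fin_cases j <;> simp_all

/-- **The twisted iterated derivative `bzTwistedDeriv S n dirs (Ψ S)` is continuous on Bouaziz's `T_{in-reg}`** when `Ψ S` is `C^∞` there ((SB).1): `archERho S · Ψ S` is
`C^∞` on the OPEN ★ `InRegS S`, its `n`-th jet is continuous there, and the twist is a continuous unit. [cite: Bouaziz1994IntegralesOrbitales, §3.2 (I₁) p. 579] -/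
theorem continuousOn_bzTwistedDeriv {Ψ : Finset W → (W → Fin 3 → ℝ) → ℂ} (S : Finset W) (hΨ : ContDiffOn ℝ ∞ (Ψ S) (InRegS S))
    (n : ℕ) (dirs : Fin n → (W → Fin 3 → ℝ)) : ContinuousOn (bzTwistedDeriv S n dirs (Ψ S)) (InRegS S) := by
  have hO : IsOpen (InRegS S) := isOpen_inRegS S
  have hg : ContDiffOn ℝ ∞ (fun c => archERho S c * Ψ S c) (InRegS S) := (contDiff_archERho S).contDiffOn.mul hΨ
  have hc : ContinuousOn (iteratedFDeriv ℝ n fun c => archERho S c * Ψ S c) (InRegS S) :=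
    (hg.continuousOn_iteratedFDerivWithin (m := n) (by exact_mod_cast le_top) hO.uniqueDiffOn).congr
      fun z hz => (iteratedFDerivWithin_of_isOpen n hO hz).symm
  have hev : Continuous fun L : (W → Fin 3 → ℝ) [×n]→L[ℝ] ℂ => L dirs := (ContinuousMultilinearMap.apply ℝ (fun _ : Fin n => W → Fin 3 → ℝ) ℂ dirs).continuous
  have h1 : ContinuousOn (fun c => (archERho S c)⁻¹) (InRegS S) :=
    ((contDiff_archERho S).continuous.continuousOn).inv₀ fun c _ => archERho_ne_zero S c
  exact h1.mul (hev.comp_continuousOn hc)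

/-! ## §2 The `G`-semiregular wall points are dense among the `H`-semiregular ones -/

omit [Fintype W] [DecidableEq W] in
/-- Moving ONLY the odd angles: `(c + t • d) w i` for `d w := ![0, 1, 0]`. [cite: Shelstad1979, §4 p. 22] -/
theorem add_smul_oddDir_apply (c : W → Fin 3 → ℝ) (t : ℝ) (w : W) :
    (c + t • (fun _ : W => ![(0 : ℝ), 1, 0])) w 0 = c w 0 ∧ (c + t • (fun _ : W => ![(0 : ℝ), 1, 0])) w 1 = c w 1 + 1 * t ∧
      (c + t • (fun _ : W => ![(0 : ℝ), 1, 0])) w 2 = c w 2 := by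
  refine ⟨?_, ?_, ?_⟩ <;>
    simp [Pi.add_apply, Pi.smul_apply, smul_eq_mul, Matrix.cons_val_zero, Matrix.cons_val_one, Matrix.cons_val_two, Matrix.head_cons, Matrix.tail_cons, mul_comm]

omit [Fintype W] [DecidableEq W] in
/-- **DENSITY OF THE `G`-SEMIREGULAR WALL POINTS.**  Let `A` be a set of coordinates stable under the motion of the odd angles `c ↦ c + t • (w ↦ (0,1,0))` and
`H`-regular at every compact place `w ≠ w₀` off `S`.  Then every point of `A` is in the closure of the `G`-semiregular part of `A` (odd eigenvalue off the colliding
pair at `w₀`, three distinct eigenvalues at the other compact places off `S`): along the line only countably many parameters are bad.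
[cite: Shelstad1979, §4 p. 22] [cite: Bouaziz1994IntegralesOrbitales, §3.2 (I₃) p. 580] -/
theorem mem_closure_gSemireg [Finite W] (S : Finset W) (w₀ : W) {A : Set (W → Fin 3 → ℝ)}
    (hline : ∀ c ∈ A, ∀ t : ℝ, c + t • (fun _ : W => ![(0 : ℝ), 1, 0]) ∈ A)
    (hreg : ∀ c ∈ A, ∀ w, w ∉ S → w ≠ w₀ → Circle.exp (c w 0) ≠ Circle.exp (c w 2)) {s : W → Fin 3 → ℝ} (hs : s ∈ A) :
    s ∈ closure (A ∩ {c | Circle.exp (c w₀ 1) ≠ Circle.exp (c w₀ 0) ∧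
      ∀ v, v ∉ S → v ≠ w₀ → Function.Injective fun i : Fin 3 => Circle.exp (c v i)}) := by
  haveI : Countable W := Finite.to_countable
  set d : W → Fin 3 → ℝ := fun _ => ![(0 : ℝ), 1, 0] with hd
  -- the countable bad set of parameters
  set B : Set ℝ := (⋃ w : W, Set.range fun m : ℤ => (s w 0 + m * (2 * π) - s w 1) / (1 - 0)) ∪
    ⋃ w : W, Set.range fun m : ℤ => (s w 2 + m * (2 * π) - s w 1) / (1 - 0) with hB
  have hBc : B.Countable := (countable_iUnion fun w => countable_range _).union (countable_iUnion fun w => countable_range _)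
  have hgood : ∀ t : ℝ, t ∉ B → s + t • d ∈ A ∩ {c | Circle.exp (c w₀ 1) ≠ Circle.exp (c w₀ 0) ∧
      ∀ v, v ∉ S → v ≠ w₀ → Function.Injective fun i : Fin 3 => Circle.exp (c v i)} := by
    intro t ht
    rw [hB, Set.mem_union, Set.mem_iUnion, Set.mem_iUnion, not_or, not_exists, not_exists] at ht
    have h10 : ∀ w, Circle.exp ((s + t • d) w 1) ≠ Circle.exp ((s + t • d) w 0) := by
      intro w
      obtain ⟨e0, e1, -⟩ := add_smul_oddDir_apply s t w
      rw [e1, e0, show s w 0 = s w 0 + 0 * t by ring]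
      exact circleExp_add_mul_ne_of_not_mem (by norm_num) (ht.1 w)
    have h12 : ∀ w, Circle.exp ((s + t • d) w 1) ≠ Circle.exp ((s + t • d) w 2) := by
      intro w
      obtain ⟨-, e1, e2⟩ := add_smul_oddDir_apply s t w
      rw [e1, e2, show s w 2 = s w 2 + 0 * t by ring]
      exact circleExp_add_mul_ne_of_not_mem (by norm_num) (ht.2 w)
    refine ⟨hline s hs t, h10 w₀, fun v hv hvw => ?_⟩
    have h02 : Circle.exp ((s + t • d) v 0) ≠ Circle.exp ((s + t • d) v 2) := by
      obtain ⟨e0, -, e2⟩ := add_smul_oddDir_apply s t v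
      rw [e0, e2]
      exact hreg s hs v hv hvw
    exact injective_of_fin_three' (h10 v).symm h02 (h12 v)
  -- every neighbourhood of `s` meets the line off `B`
  rw [_root_.mem_closure_iff]
  intro o ho hso
  have hl : Continuous fun t : ℝ => s + t • d := continuous_const.add (continuous_id.smul continuous_const)
  have hpre : IsOpen ((fun t : ℝ => s + t • d) ⁻¹' o) := ho.preimage hl
  have h0 : (0 : ℝ) ∈ (fun t : ℝ => s + t • d) ⁻¹' o := by
    show s + (0 : ℝ) • d ∈ o
    rwa [zero_smul, add_zero]
  obtain ⟨t, htB, hto⟩ := (hBc.dense_compl ℝ).exists_mem_open hpre ⟨0, h0⟩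
  exact ⟨s + t • d, hto, hgood t htB⟩

/-! ## §3 The propagation theorem -/

/-- **(π) PROPAGATION OF THE JUMP CLAUSE.**  For a family `Ψ` with Bouaziz's (I₁)+(I₂) (★ `ArchBzSmoothBounded Ψ`): if the jump relations (I₃) with constants `jcH` hold at
every `G`-SEMIREGULAR wall point (`p w₀ 0 = p w₀ 2`, the odd eigenvalue `e^{i p_{w₀1}}` off the colliding pair, three distinct eigenvalues at every other compact place
off `S`, `x ≠ 0` at the split places), all orders and all words, then ★ `ArchBzJump jcH Ψ` holds (every `H`-semiregular wall point).  Both sides of the clause are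
continuous along the wall (one-sided jet fields ★ `exists_continuousOn_oneSided_iteratedFDeriv_pair`; (SB) at the Cayley point), the `G`-semiregular points are dense
(`mem_closure_gSemireg`), jumps are unique (★ `HasOneSidedJump.unique`). [cite: Bouaziz1994IntegralesOrbitales, §3.2 (I₁)–(I₃) pp. 579–580] [cite: Shelstad1979, Prop. 4.5 (p. 26)] -/
theorem archBzJump_of_forall_gSemireg {jcH : Finset W → W → ℂ} {Ψ : Finset W → (W → Fin 3 → ℝ) → ℂ} (hSB : ArchBzSmoothBounded Ψ)
    (h : ∀ (S : Finset W) (w₀ : W), w₀ ∉ S → ∀ p : W → Fin 3 → ℝ, p w₀ 0 = p w₀ 2 →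
      Circle.exp (p w₀ 1) ≠ Circle.exp (p w₀ 0) →
      (∀ v, v ∉ S → v ≠ w₀ → Function.Injective fun i : Fin 3 => Circle.exp (p v i)) →
      (∀ v ∈ S, p v 0 ≠ 0) →
      ∀ (n : ℕ) (m : Fin n → W × Fin 3),
        HasOneSidedJump (fun ν : ℝ => bzTwistedDeriv S n (fun j => bzAdaptedVec w₀ (m j)) (Ψ S) (p + ν • nrm w₀))
          (jcH S w₀ * bzCayScalar w₀ m * bzTwistedDeriv (insert w₀ S) n (fun j => bzCayVec (m j)) (Ψ (insert w₀ S)) (cayPt w₀ p))) :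
    ArchBzJump jcH Ψ := by
  intro S w₀ hw₀ s hs02 hsreg hsx n m
  -- the slot-difference functional and the transversal
  set ℓ : (W → Fin 3 → ℝ) →L[ℝ] ℝ :=
    (ContinuousLinearMap.proj (R := ℝ) (φ := fun _ : Fin 3 => ℝ) (0 : Fin 3)).comp
        (ContinuousLinearMap.proj (R := ℝ) (φ := fun _ : W => Fin 3 → ℝ) w₀) -
      (ContinuousLinearMap.proj (R := ℝ) (φ := fun _ : Fin 3 => ℝ) (2 : Fin 3)).comp
        (ContinuousLinearMap.proj (R := ℝ) (φ := fun _ : W => Fin 3 → ℝ) w₀) with hℓdef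
  have hℓ : ∀ c : W → Fin 3 → ℝ, ℓ c = c w₀ 0 - c w₀ 2 := fun c => rfl
  have hℓv : 0 < ℓ (nrm w₀) := by rw [hℓ]; simp [nrm]
  -- the open set `U` and its trace on the wall
  set U : Set (W → Fin 3 → ℝ) :=
    {c | |c w₀ 0 - c w₀ 2| < 2 * π} ∩ InRegS (insert w₀ S) ∩ {c | ∀ w ∈ S, c w 0 ≠ 0} with hUdef
  have hUo : IsOpen U := by
    refine (IsOpen.inter ?_ (isOpen_inRegS _)).inter ?_
    · exact isOpen_lt ((continuous_apply_apply w₀ (0 : Fin 3)).sub (continuous_apply_apply w₀ (2 : Fin 3))).abs continuous_const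
    · have : {c : W → Fin 3 → ℝ | ∀ w ∈ S, c w 0 ≠ 0} = ⋂ w ∈ S, {c | c w 0 ≠ 0} := by ext c; simp
      rw [this]
      exact isOpen_biInter_finset fun w _ => isOpen_ne_fun (continuous_apply_apply w (0 : Fin 3)) continuous_const
  have hinRegS' : ∀ c : W → Fin 3 → ℝ, c ∈ InRegS (insert w₀ S) ↔ ∀ w, w ∉ S → w ≠ w₀ → Circle.exp (c w 0) ≠ Circle.exp (c w 2) := by
    intro c
    simp only [InRegS, mem_setOf_eq, Finset.mem_insert, not_or]
    exact ⟨fun H w hw hww => H w ⟨hww, hw⟩, fun H w hw => H w hw.2 hw.1⟩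
  -- off the wall, `U` lies in `T_{in-reg}` of `S`
  have hUreg : U ∩ {c | ℓ c ≠ 0} ⊆ InRegS S := by
    rintro c ⟨⟨⟨habs, hreg'⟩, -⟩, hne⟩ w hw
    by_cases hww : w = w₀
    · rw [hww]
      intro heq
      obtain ⟨k, hk⟩ := Circle.exp_eq_exp.1 heq
      have hk' : c w₀ 0 - c w₀ 2 = k * (2 * π) := by linarith
      have h1 : |(k : ℝ)| * (2 * π) < 2 * π := by
        have h0 := habs
        rw [mem_setOf_eq, hk', abs_mul, abs_of_pos Real.two_pi_pos] at h0
        exact h0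
      have h2 : |(k : ℝ)| < 1 := (mul_lt_iff_lt_one_left Real.two_pi_pos).1 h1
      have h3 : k = 0 := by
        have h4 : ((|k| : ℤ) : ℝ) < 1 := by rwa [Int.cast_abs]
        exact Int.abs_lt_one_iff.1 (by exact_mod_cast h4)
      apply hne
      show ℓ c = 0
      rw [hℓ, hk', h3]
      simp
    · exact (hinRegS' c).1 hreg' w hw hww
  -- the wall scope is the trace of `U` on the hyperplane `{ℓ = 0}`
  have hwall : ∀ c ∈ U, ℓ c = 0 → c w₀ 0 = c w₀ 2 ∧ (∀ w, w ∉ S → w ≠ w₀ → Circle.exp (c w 0) ≠ Circle.exp (c w 2)) ∧ ∀ w ∈ S, c w 0 ≠ 0 := by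
    rintro c ⟨⟨-, hreg'⟩, hx'⟩ hc0
    exact ⟨by rw [hℓ] at hc0; linarith, (hinRegS' c).1 hreg', hx'⟩
  have hsU : s ∈ U := by
    refine ⟨⟨?_, (hinRegS' s).2 hsreg⟩, hsx⟩
    show |s w₀ 0 - s w₀ 2| < 2 * π
    rw [hs02, sub_self, abs_zero]; exact Real.two_pi_pos
  have hsℓ : ℓ s = 0 := by rw [hℓ, hs02, sub_self]
  -- the twisted function and its jets
  set f : (W → Fin 3 → ℝ) → ℂ := fun c => archERho S c * Ψ S c with hfdef
  have hfO : ContDiffOn ℝ ∞ f (InRegS S) := (contDiff_archERho S).contDiffOn.mul (hSB S).1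
  have hf : ContDiffOn ℝ ∞ f (U ∩ {c | ℓ c ≠ 0}) := hfO.mono hUreg
  have hb : ∀ x ∈ U, ℓ x = 0 → ∃ C : ℝ, ∀ᶠ y in 𝓝 x, ℓ y ≠ 0 → ‖iteratedFDeriv ℝ (n + 1) f y‖ ≤ C := by
    intro x hxU _
    have hK : IsCompact (closedBall x 1) := isCompact_closedBall x 1
    obtain ⟨C, hC⟩ := bddAbove_norm_iteratedFDeriv_mul_inter_of_isCompact (isOpen_inRegS S) isOpen_univ hK (subset_univ _)
      (contDiff_archERho S).contDiffOn (hSB S).1 (n := n + 1) (fun i _ => (hSB S).2 i _ hK)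
    refine ⟨C, ?_⟩
    filter_upwards [hUo.mem_nhds hxU, closedBall_mem_nhds x one_pos] with y hyU hyB hy0
    exact mem_upperBounds.1 hC _ ⟨y, ⟨hyB, hUreg ⟨hyU, hy0⟩⟩, rfl⟩
  obtain ⟨gp, gm, hgpc, hgmc, -, -, hlims⟩ := exists_continuousOn_oneSided_iteratedFDeriv_pair ℓ 0 hℓv hUo hf n hb
  -- the word, the one-sided limits of the left side, the right side
  set dirs : Fin n → (W → Fin 3 → ℝ) := fun j => bzAdaptedVec w₀ (m j) with hdirs
  have hev : Continuous fun L : (W → Fin 3 → ℝ) [×n]→L[ℝ] ℂ => L dirs :=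
    (ContinuousMultilinearMap.apply ℝ (fun _ : Fin n => W → Fin 3 → ℝ) ℂ dirs).continuous
  set Lp : (W → Fin 3 → ℝ) → ℂ := fun c => (archERho S c)⁻¹ * gp c dirs with hLp
  set Lm : (W → Fin 3 → ℝ) → ℂ := fun c => (archERho S c)⁻¹ * gm c dirs with hLm
  set R : (W → Fin 3 → ℝ) → ℂ := fun c => jcH S w₀ * bzCayScalar w₀ m *
    bzTwistedDeriv (insert w₀ S) n (fun j => bzCayVec (m j)) (Ψ (insert w₀ S)) (cayPt w₀ c) with hR
  set Wall : Set (W → Fin 3 → ℝ) := U ∩ {c | ℓ c = 0} with hWall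
  -- one-sided limits of the left side at every wall point
  have hLHS : ∀ c ∈ Wall,
      Tendsto (fun ν : ℝ => bzTwistedDeriv S n dirs (Ψ S) (c + ν • nrm w₀)) (𝓝[>] 0) (𝓝 (Lp c)) ∧
      Tendsto (fun ν : ℝ => bzTwistedDeriv S n dirs (Ψ S) (c + ν • nrm w₀)) (𝓝[<] 0) (𝓝 (Lm c)) := by
    intro c hc
    obtain ⟨h1, h2⟩ := hlims c hc.1 hc.2
    have hρc : Continuous fun ν : ℝ => archERho S (c + ν • nrm w₀) :=
      (contDiff_archERho S).continuous.comp (continuous_const.add (continuous_id.smul continuous_const))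
    have hρ : Tendsto (fun ν : ℝ => (archERho S (c + ν • nrm w₀))⁻¹) (𝓝 0) (𝓝 (archERho S c)⁻¹) := by
      have h0 := hρc.tendsto 0
      simp only [zero_smul, add_zero] at h0
      exact h0.inv₀ (archERho_ne_zero S c)
    have key : ∀ ν : ℝ, bzTwistedDeriv S n dirs (Ψ S) (c + ν • nrm w₀) =
        (archERho S (c + ν • nrm w₀))⁻¹ * iteratedFDeriv ℝ n f (c + ν • nrm w₀) dirs := fun ν => rfl
    simp only [key]
    exact ⟨(hρ.mono_left nhdsWithin_le_nhds).mul ((hev.tendsto _).comp h1),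
      (hρ.mono_left nhdsWithin_le_nhds).mul ((hev.tendsto _).comp h2)⟩
  -- continuity of both sides along the wall
  have hWp : Wall ⊆ U ∩ {c | (0 : ℝ) ≤ ℓ c} := fun c hc => ⟨hc.1, le_of_eq (Eq.symm hc.2)⟩
  have hWm : Wall ⊆ U ∩ {c | ℓ c ≤ 0} := fun c hc => ⟨hc.1, le_of_eq hc.2⟩
  have hρinv : Continuous fun c : W → Fin 3 → ℝ => (archERho S c)⁻¹ :=
    (contDiff_archERho S).continuous.inv₀ fun c => archERho_ne_zero S c
  have hLp_cont : ContinuousOn Lp Wall := hρinv.continuousOn.mul (hev.comp_continuousOn (hgpc.mono hWp))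
  have hLm_cont : ContinuousOn Lm Wall := hρinv.continuousOn.mul (hev.comp_continuousOn (hgmc.mono hWm))
  have hR_cont : ContinuousOn R Wall := by
    have h1 : ContinuousOn (bzTwistedDeriv (insert w₀ S) n (fun j => bzCayVec (m j)) (Ψ (insert w₀ S))) (InRegS (insert w₀ S)) :=
      continuousOn_bzTwistedDeriv (insert w₀ S) (hSB (insert w₀ S)).1 n _
    have h2 : MapsTo (cayPt w₀) Wall (InRegS (insert w₀ S)) := fun c hc =>
      cayPt_mem_inRegS_insert_of_semiregular S w₀ (hwall c hc.1 hc.2).2.1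
    have h3 : ContinuousOn (fun c => bzTwistedDeriv (insert w₀ S) n (fun j => bzCayVec (m j)) (Ψ (insert w₀ S)) (cayPt w₀ c)) Wall :=
      h1.comp (contDiff_cayPt w₀).continuous.continuousOn h2
    exact continuousOn_const.mul h3
  -- the `G`-semiregular wall points are dense in the wall scope
  have hdense : Wall ⊆ closure (Wall ∩ {c | Circle.exp (c w₀ 1) ≠ Circle.exp (c w₀ 0) ∧
      ∀ v, v ∉ S → v ≠ w₀ → Function.Injective fun i : Fin 3 => Circle.exp (c v i)}) := by
    intro c hc
    refine mem_closure_gSemireg S w₀ (A := Wall) (fun c' hc' t => ?_) (fun c' hc' => (hwall c' hc'.1 hc'.2).2.1) hc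
    -- the wall scope is stable under the motion of the odd angles
    have e : ∀ w, (c' + t • (fun _ : W => ![(0 : ℝ), 1, 0])) w 0 = c' w 0 ∧ (c' + t • (fun _ : W => ![(0 : ℝ), 1, 0])) w 2 = c' w 2 :=
      fun w => ⟨(add_smul_oddDir_apply c' t w).1, (add_smul_oddDir_apply c' t w).2.2⟩
    obtain ⟨⟨⟨habs, hreg'⟩, hx'⟩, hc0⟩ := hc'
    refine ⟨⟨⟨?_, ?_⟩, ?_⟩, ?_⟩
    · show |(c' + t • (fun _ : W => ![(0 : ℝ), 1, 0])) w₀ 0 - (c' + t • (fun _ : W => ![(0 : ℝ), 1, 0])) w₀ 2| < 2 * π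
      rw [(e w₀).1, (e w₀).2]; exact habs
    · rw [hinRegS'] at hreg' ⊢
      intro w hw hww
      rw [(e w).1, (e w).2]; exact hreg' w hw hww
    · intro w hw
      show (c' + t • (fun _ : W => ![(0 : ℝ), 1, 0])) w 0 ≠ 0
      rw [(e w).1]; exact hx' w hw
    · show ℓ (c' + t • (fun _ : W => ![(0 : ℝ), 1, 0])) = 0
      rw [hℓ, (e w₀).1, (e w₀).2, ← hℓ]; exact hc0
  -- on the dense part the two sides agree (uniqueness of jumps), hence everywhere (continuity)
  have hEqD : EqOn (fun c => Lp c - Lm c) R (Wall ∩ {c | Circle.exp (c w₀ 1) ≠ Circle.exp (c w₀ 0) ∧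
      ∀ v, v ∉ S → v ≠ w₀ → Function.Injective fun i : Fin 3 => Circle.exp (c v i)}) := by
    rintro c ⟨hcW, hcG⟩
    obtain ⟨hc02, _, hcx⟩ := hwall c hcW.1 hcW.2
    have hJ := h S w₀ hw₀ c hc02 hcG.1 hcG.2 hcx n m
    have hJ' : HasOneSidedJump (fun ν : ℝ => bzTwistedDeriv S n dirs (Ψ S) (c + ν • nrm w₀)) (Lp c - Lm c) :=
      ⟨Lp c, Lm c, (hLHS c hcW).1, (hLHS c hcW).2, rfl⟩
    exact hJ'.unique hJ
  have hEq : EqOn (fun c => Lp c - Lm c) R Wall :=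
    hEqD.of_subset_closure (hLp_cont.sub hLm_cont) hR_cont inter_subset_left hdense
  -- conclusion at `s`
  have hsW : s ∈ Wall := ⟨hsU, hsℓ⟩
  exact ⟨Lp s, Lm s, (hLHS s hsW).1, (hLHS s hsW).2, hEq hsW⟩

end Literature.NumberTheory.Rogawski1990
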